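import Summits.Ventures.HodgeRepro2.T6A3BaseChange
import Summits.Ventures.HodgeRepro2.T6A3Pairing

/-!
# T6-A3 — the integral model: `∫_B ∘ Φ = volB · ∫` on the eigenbasis model

Tier 6 (README §10), sub-goal A3, seat t6-p3; proof lane.  The transported pairing identity
(`T6A3PairingKappa.pairing_identity_H_kappa`) consumes the local predicate
`IntegralModel Φ intB volB : volB ≠ 0 ∧ ∀ x, intB (Φ x) = volB * integral x` — the complex
integral `∫_B` on `H^*(B, ℂ)` is, through the eigenbasis model `Φ : A ι ≃ₐ[ℂ] HBC K`, a non-zero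
multiple of p5's model integral (which is `±1` on the top monomial `e_ℬ` and `0` on every other
monomial).  This file discharges it from the two printed facts the interface carries about `∫_B`
(`T6Interface.TransferShadow.intB_deg`: `∫_B` kills every degree but `2 dim B = 24`;
`intB_ne_zero`: it is non-zero in the top degree — Poincaré duality, Bredon VI.8.3), for any GRADED
eigenbasis model `Φ` (hypotheses `hΦ`, `hΦ'`: `Φ` and `Φ⁻¹` preserve the exterior degree; proved for
the `Φ` of `T6A3Main` from its construction).

Steps: (i) `intBC D` kills `⋀^k_ℂ H¹(B, ℂ)` for `k ≠ 24` (`⋀^k_ℂ` is the ℂ-span of the rational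
classes `extC K (⋀^k_ℚ)`, induction on `k` with `ιMulti_succ_apply`); (ii) the monomial basis of the
model (Mathlib `Module.Basis.ExteriorAlgebra` over a linear order on the generators) consists of
p5's monomials `mono l`, on which `integral` is `0` unless `l` exhausts the generators and `±1`
then; (iii) both functionals `intBC D ∘ Φ` and `integral` vanish on every non-top basis monomial,
so they are proportional (`Module.Basis.ext`), with the ratio `volB ≠ 0` by `intB_ne_zero`.
Nothing here is a display.
-/

open scoped TensorProduct

namespace Summit.Ventures.HodgeRepro2.T6.A3IntegralModel

open WeilPlanes WeilIntegral WeilDetect A3ExtBC A3BaseChange A3Pairing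

/-! ## 1. `∫_B` on `H^*(B, ℂ)` kills every degree but the top one -/

section Degree

variable {K : Type*} [Field K] [NumberField K]

/-- `H¹(B, ℂ)` is spanned over ℂ by the rational vectors `h1ToC K v`. -/
theorem span_h1ToC_eq_top : Submodule.span ℂ (Set.range (h1ToC K)) = ⊤ := by
  rw [Submodule.eq_top_iff']
  intro w
  rw [← Finset.univ_sum_single w]
  refine Submodule.sum_mem _ fun i _ => ?_
  -- `w i ∈ ℂ ⊗[ℚ] K` is a ℂ-combination of pure tensors `1 ⊗ x`
  induction w i using TensorProduct.induction_on with
  | zero => simp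
  | tmul c x =>
    have h : (Pi.single i (c ⊗ₜ[ℚ] x) : H1C K) = c • h1ToC K (Pi.single i x) := by
      ext j
      by_cases hij : j = i
      · subst hij
        simp [h1ToC, TensorProduct.smul_tmul']
      · simp [h1ToC, hij]
    rw [h]
    exact Submodule.smul_mem _ _ (Submodule.subset_span ⟨_, rfl⟩)
  | add x y hx hy =>
    rw [Pi.single_add]
    exact Submodule.add_mem _ hx hy

/-- `extC K` respects the wedge monomials. -/
theorem extC_ιMulti {n : ℕ} (v : Fin n → H1 K) :
    extC K (ExteriorAlgebra.ιMulti ℚ n v) = ExteriorAlgebra.ιMulti ℂ n (fun i => h1ToC K (v i)) := by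
  rw [ExteriorAlgebra.ιMulti_apply, ExteriorAlgebra.ιMulti_apply, map_list_prod, List.map_ofFn]
  refine congrArg List.prod (congrArg List.ofFn (funext fun i => ?_))
  simp only [Function.comp_apply]
  unfold extC
  rw [ExteriorAlgebra.lift_ι_apply]
  rfl

/-- `extC K` is graded. -/
theorem extC_mem_exteriorPower {n : ℕ} {a : HB K} (ha : a ∈ ⋀[ℚ]^n (H1 K)) :
    extC K a ∈ ⋀[ℂ]^n (H1C K) := by
  rw [← ExteriorAlgebra.ιMulti_span_fixedDegree] at ha
  induction ha using Submodule.span_induction with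
  | mem x hx =>
    obtain ⟨v, rfl⟩ := hx
    rw [extC_ιMulti]
    exact ExteriorAlgebra.ιMulti_range ℂ n ⟨_, rfl⟩
  | zero => simp
  | add x y _ _ hx hy => rw [map_add]; exact Submodule.add_mem _ hx hy
  | smul r x _ hx =>
    rw [map_smul]
    exact Submodule.smul_of_tower_mem _ r hx

/-- `⋀^k_ℂ H¹(B, ℂ)` is the ℂ-span of the rational classes of degree `k`. -/
theorem exteriorPower_le_span_extC (k : ℕ) :
    ⋀[ℂ]^k (H1C K) ≤ Submodule.span ℂ (extC K '' (⋀[ℚ]^k (H1 K) : Set (HB K))) := by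
  rw [← ExteriorAlgebra.ιMulti_span_fixedDegree, Submodule.span_le]
  rintro _ ⟨w, rfl⟩
  induction k with
  | zero =>
    rw [ExteriorAlgebra.ιMulti_zero_apply]
    exact Submodule.subset_span ⟨1, SetLike.one_mem_graded _, map_one _⟩
  | succ k ih =>
    rw [ExteriorAlgebra.ιMulti_succ_apply]
    -- the first factor lies in the span of the rational degree-one classes
    have h0 : ExteriorAlgebra.ι ℂ (w 0) ∈
        Submodule.span ℂ (extC K '' (⋀[ℚ]^1 (H1 K) : Set (HB K))) := by
      have hw : w 0 ∈ Submodule.span ℂ (Set.range (h1ToC K)) := by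
        rw [span_h1ToC_eq_top]; trivial
      have hmap := Submodule.mem_map_of_mem (f := (ExteriorAlgebra.ι ℂ : H1C K →ₗ[ℂ] HBC K)) hw
      rw [Submodule.map_span] at hmap
      refine Submodule.span_mono ?_ hmap
      rintro _ ⟨_, ⟨v, rfl⟩, rfl⟩
      refine ⟨ExteriorAlgebra.ι ℚ v, ?_, ?_⟩
      · exact ExteriorAlgebra.ιMulti_range ℚ 1 ⟨fun _ => v, by simp [ExteriorAlgebra.ιMulti_apply]⟩
      · unfold extC
        rw [ExteriorAlgebra.lift_ι_apply]
        rfl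
    have h1 := ih (Matrix.vecTail w)
    have hmul := Submodule.mul_mem_mul h0 h1
    rw [Submodule.span_mul_span] at hmul
    refine Submodule.span_mono ?_ hmul
    rintro _ ⟨_, ⟨a, ha, rfl⟩, _, ⟨b, hb, rfl⟩, rfl⟩
    refine ⟨a * b, ?_, by rw [map_mul]⟩
    have := SetLike.mul_mem_graded ha hb
    rwa [Nat.add_comm] at this

variable {F : FaceSetting K} (D : TransferShadow F)

/-- `∫_B` on `H^*(B, ℂ)` vanishes in every degree `k ≠ 24`. -/
theorem intBC_eq_zero_of_mem_exteriorPower {k : ℕ} (hk : k ≠ 24) {y : HBC K}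
    (hy : y ∈ ⋀[ℂ]^k (H1C K)) : intBC D y = 0 := by
  have hle : Submodule.span ℂ (extC K '' (⋀[ℚ]^k (H1 K) : Set (HB K))) ≤
      LinearMap.ker (intBC D) := by
    rw [Submodule.span_le]
    rintro _ ⟨a, ha, rfl⟩
    rw [SetLike.mem_coe, LinearMap.mem_ker, intBC_extC, D.intB_deg k hk a ha, Rat.cast_zero]
  exact hle (exteriorPower_le_span_extC k hy)

end Degree

/-! ## 2. The monomial basis of the model and p5's integral on it -/

section Model

variable (ι : Type*) [DecidableEq ι] [Fintype ι]

/-- An enumeration of the generators by `Fin N`, `N = 2 |ι|`. -/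
noncomputable def genEnum : Gen ι ≃ Fin (Fintype.card (Gen ι)) := Fintype.equivFin (Gen ι)

/-- The standard basis of `V ι = (Gen ι → ℂ)` indexed by `Fin N`. -/
noncomputable def genBasis : Module.Basis (Fin (Fintype.card (Gen ι))) ℂ (V ι) :=
  (Pi.basisFun ℂ (Gen ι)).reindex (genEnum ι)

/-- `ι (genBasis k) = gen (genEnum⁻¹ k)`. -/
theorem genBasis_apply (k : Fin (Fintype.card (Gen ι))) :
    ExteriorAlgebra.ι ℂ (genBasis ι k) = gen ((genEnum ι).symm k) := by
  rw [genBasis, Module.Basis.reindex_apply, Pi.basisFun_apply]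
  rfl

/-- The monomial basis of the model `A ι` (Mathlib's `Module.Basis.ExteriorAlgebra`). -/
noncomputable def monoBasis : Module.Basis (Finset (Fin (Fintype.card (Gen ι)))) ℂ (A ι) :=
  (genBasis ι).ExteriorAlgebra

/-- The generators of `s`, in increasing order of their enumeration. -/
noncomputable def sortedList (s : Finset (Fin (Fintype.card (Gen ι)))) : List (Gen ι) :=
  List.ofFn (fun i => (genEnum ι).symm (s.orderEmbOfFin rfl i))

/-- The basis monomial of `s` is p5's `mono` of the sorted generator list of `s`. -/
theorem monoBasis_apply (s : Finset (Fin (Fintype.card (Gen ι)))) :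
    monoBasis ι s = mono (sortedList ι s) := by
  unfold monoBasis sortedList mono
  rw [ExteriorAlgebra.basis_apply_ofCard (genBasis ι) rfl, ExteriorAlgebra.ιMulti_family,
    ExteriorAlgebra.ιMulti_apply, List.map_ofFn]
  refine congrArg List.prod (congrArg List.ofFn (funext fun i => ?_))
  simp only [Function.comp_apply, Set.powersetCard.ofFinEmbEquiv_symm_apply, genBasis_apply]
  rfl

omit [DecidableEq ι] in
/-- The sorted generator list has no repetition. -/
theorem nodup_sortedList (s : Finset (Fin (Fintype.card (Gen ι)))) : (sortedList ι s).Nodup := by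
  unfold sortedList
  rw [List.nodup_ofFn]
  exact (genEnum ι).symm.injective.comp (s.orderEmbOfFin rfl).injective

omit [DecidableEq ι] in
/-- `j ∈ sortedList s ↔ genEnum j ∈ s`. -/
theorem mem_sortedList (s : Finset (Fin (Fintype.card (Gen ι)))) (j : Gen ι) :
    j ∈ sortedList ι s ↔ genEnum ι j ∈ s := by
  unfold sortedList
  rw [List.mem_ofFn]
  constructor
  · rintro ⟨i, rfl⟩
    rw [Equiv.apply_symm_apply]
    exact s.orderEmbOfFin_mem rfl i
  · intro hj
    have : genEnum ι j ∈ Set.range (s.orderEmbOfFin rfl) := by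
      rw [Finset.range_orderEmbOfFin]; exact hj
    obtain ⟨i, hi⟩ := this
    exact ⟨i, by rw [hi]; simp⟩

/-- p5's integral vanishes on every basis monomial but the top one. -/
theorem integral_monoBasis_of_ne (s : Finset (Fin (Fintype.card (Gen ι)))) (hs : s ≠ Finset.univ) :
    integral (monoBasis ι s) = 0 := by
  rw [monoBasis_apply]
  apply integral_mono_eq_zero
  right
  obtain ⟨k, _, hk⟩ := Finset.exists_mem_notMem_of_card_lt_card
    (Finset.card_lt_card (Finset.ssubset_univ_iff.mpr hs))
  refine ⟨(genEnum ι).symm k, fun h => hk ?_⟩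
  have := (mem_sortedList ι s _).mp h
  simpa using this

/-- p5's integral is `±1` on the top basis monomial `e_ℬ`. -/
theorem integral_monoBasis_univ :
    ∃ ε : ℂ, (ε = 1 ∨ ε = -1) ∧ integral (monoBasis ι Finset.univ) = ε := by
  rw [monoBasis_apply]
  exact integral_mono_of_forall_mem (nodup_sortedList ι _)
    (fun j => (mem_sortedList ι Finset.univ j).mpr (Finset.mem_univ _))

omit [DecidableEq ι] in
/-- The basis monomial of `s` has degree `|s|`. -/
theorem monoBasis_mem_exteriorPower (s : Finset (Fin (Fintype.card (Gen ι)))) :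
    monoBasis ι s ∈ ⋀[ℂ]^s.card (V ι) := by
  unfold monoBasis
  rw [ExteriorAlgebra.basis_apply_ofCard (genBasis ι) rfl, ExteriorAlgebra.ιMulti_family]
  exact ExteriorAlgebra.ιMulti_range ℂ _ ⟨_, rfl⟩

end Model

/-! ## 3. `∫_B ∘ Φ = volB · ∫` -/

section Proportional

variable {K : Type*} [Field K] [NumberField K] {F : FaceSetting K} (D : TransferShadow F)
variable {ι : Type*} [DecidableEq ι] [Fintype ι] (Φ : A ι ≃ₐ[ℂ] HBC K)

omit [DecidableEq ι] in
/-- The number of generators of the twelve-plane model is `24`. -/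
theorem card_gen (hι : Fintype.card ι = 12) : Fintype.card (Gen ι) = 24 := by
  simp [Gen, Fintype.card_prod, hι]

omit [DecidableEq ι] in
/-- `∫_B ∘ Φ` vanishes on every non-top basis monomial (the degree of `Φ (B s)` is `|s| ≠ 24`). -/
theorem intBC_Φ_monoBasis_of_ne (hι : Fintype.card ι = 12)
    (hΦ : ∀ (n : ℕ) (x : A ι), x ∈ ⋀[ℂ]^n (V ι) → Φ x ∈ ⋀[ℂ]^n (H1C K))
    (s : Finset (Fin (Fintype.card (Gen ι)))) (hs : s ≠ Finset.univ) :
    intBC D (Φ (monoBasis ι s)) = 0 := by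
  have hcard : s.card ≠ 24 := by
    intro h
    apply hs
    rw [← Finset.card_eq_iff_eq_univ, h, Fintype.card_fin, card_gen hι]
  exact intBC_eq_zero_of_mem_exteriorPower D hcard (hΦ _ _ (monoBasis_mem_exteriorPower ι s))

/-- The normalising constant `volB = ∫_B Φ(e_ℬ) / ∫ e_ℬ`. -/
noncomputable def volB : ℂ :=
  intBC D (Φ (monoBasis ι Finset.univ)) / integral (monoBasis ι Finset.univ)

/-- `∫ e_ℬ ≠ 0` (it is `±1`). -/
theorem integral_monoBasis_univ_ne_zero : integral (monoBasis ι Finset.univ) ≠ 0 := by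
  obtain ⟨ε, hε, h⟩ := integral_monoBasis_univ ι
  rw [h]
  rcases hε with rfl | rfl <;> norm_num

/-- **The proportionality `∫_B ∘ Φ = volB · ∫`** (both functionals vanish on every non-top basis
monomial and agree on `e_ℬ` by the choice of `volB`). -/
theorem intBC_Φ_eq (hι : Fintype.card ι = 12)
    (hΦ : ∀ (n : ℕ) (x : A ι), x ∈ ⋀[ℂ]^n (V ι) → Φ x ∈ ⋀[ℂ]^n (H1C K)) (x : A ι) :
    intBC D (Φ x) = volB D Φ * integral x := by
  have key : intBC D ∘ₗ Φ.toLinearMap = volB D Φ • (integral : A ι →ₗ[ℂ] ℂ) := by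
    apply (monoBasis ι).ext
    intro s
    simp only [LinearMap.comp_apply, AlgEquiv.toLinearMap_apply, LinearMap.smul_apply,
      smul_eq_mul]
    by_cases hs : s = Finset.univ
    · subst hs
      unfold volB
      rw [div_mul_cancel₀ _ (integral_monoBasis_univ_ne_zero (ι := ι))]
    · rw [intBC_Φ_monoBasis_of_ne D Φ hι hΦ s hs, integral_monoBasis_of_ne ι s hs, mul_zero]
  have := LinearMap.congr_fun key x
  simpa using this

omit [DecidableEq ι] in
/-- Every `N`-subset of the `N` generators is the full set. -/
theorem powersetCard_eq_univ (s : Set.powersetCard (Fin (Fintype.card (Gen ι))) (Fintype.card (Gen ι))) :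
    s.val = Finset.univ := by
  have hs : s.val.card = Fintype.card (Gen ι) := s.2
  rw [← Finset.card_eq_iff_eq_univ, hs, Fintype.card_fin]

omit [DecidableEq ι] in
/-- The top exterior power of the model is the line spanned by `e_ℬ` (the basis of `⋀^N` is
indexed by the `N`-subsets of the `N` generators: only `univ`). -/
theorem mem_top_exteriorPower {x : A ι} (hx : x ∈ ⋀[ℂ]^(Fintype.card (Gen ι)) (V ι)) :
    ∃ c : ℂ, x = c • monoBasis ι Finset.univ := by
  have hu : (Finset.univ : Finset (Fin (Fintype.card (Gen ι)))).card = Fintype.card (Gen ι) := by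
    rw [Finset.card_univ, Fintype.card_fin]
  set s₀ : Set.powersetCard (Fin (Fintype.card (Gen ι))) (Fintype.card (Gen ι)) :=
    Set.powersetCard.ofCard hu with hs₀
  have hsub : ∀ s : Set.powersetCard (Fin (Fintype.card (Gen ι))) (Fintype.card (Gen ι)), s = s₀ :=
    fun s => Subtype.ext (powersetCard_eq_univ s)
  have hrange : Set.range ((genBasis ι).exteriorPower (Fintype.card (Gen ι))) =
      {(genBasis ι).exteriorPower (Fintype.card (Gen ι)) s₀} := by
    ext y
    constructor
    · rintro ⟨s, rfl⟩
      rw [hsub s]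
      rfl
    · rintro rfl
      exact ⟨s₀, rfl⟩
  have hmem := Module.Basis.mem_span ((genBasis ι).exteriorPower (Fintype.card (Gen ι))) ⟨x, hx⟩
  rw [hrange, Submodule.mem_span_singleton] at hmem
  obtain ⟨c, hc⟩ := hmem
  refine ⟨c, ?_⟩
  have hval := congrArg Subtype.val hc
  rw [Submodule.coe_smul] at hval
  have hB : monoBasis ι Finset.univ =
      ((genBasis ι).exteriorPower (Fintype.card (Gen ι)) s₀ : A ι) := by
    unfold monoBasis
    exact ExteriorAlgebra.basis_eq_coe_basis (genBasis ι) s₀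
  rw [hB, hval]

omit [DecidableEq ι] in
/-- `∫_B` is non-zero on the top monomial `Φ e_ℬ` (Poincaré duality: `intB_ne_zero`). -/
theorem intBC_Φ_monoBasis_univ_ne_zero (hι : Fintype.card ι = 12)
    (hΦ' : ∀ (n : ℕ) (y : HBC K), y ∈ ⋀[ℂ]^n (H1C K) → Φ.symm y ∈ ⋀[ℂ]^n (V ι)) :
    intBC D (Φ (monoBasis ι Finset.univ)) ≠ 0 := by
  obtain ⟨a, ha, hne⟩ := D.intB_ne_zero
  have hy : extC K a ∈ ⋀[ℂ]^(Fintype.card (Gen ι)) (H1C K) := by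
    rw [card_gen hι]; exact extC_mem_exteriorPower ha
  obtain ⟨c, hc⟩ := mem_top_exteriorPower (hΦ' _ _ hy)
  have hcast : (D.intB a : ℂ) ≠ 0 := by exact_mod_cast hne
  rw [← intBC_extC D a, ← Φ.apply_symm_apply (extC K a), hc, map_smul, map_smul, smul_eq_mul] at hcast
  exact right_ne_zero_of_mul hcast

/-- `volB ≠ 0`. -/
theorem volB_ne_zero (hι : Fintype.card ι = 12)
    (hΦ' : ∀ (n : ℕ) (y : HBC K), y ∈ ⋀[ℂ]^n (H1C K) → Φ.symm y ∈ ⋀[ℂ]^n (V ι)) :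
    volB D Φ ≠ 0 :=
  div_ne_zero (intBC_Φ_monoBasis_univ_ne_zero D Φ hι hΦ') (integral_monoBasis_univ_ne_zero (ι := ι))

/-- **THE INTEGRAL MODEL:** for a graded eigenbasis model `Φ` of the twelve-plane model,
`∫_B ∘ Φ = volB · ∫` with `volB ≠ 0` — the predicate `IntegralModel` of `T6A3Pairing`, discharged
from `intB_deg` and `intB_ne_zero` (Poincaré duality). -/
theorem integralModel (hι : Fintype.card ι = 12)
    (hΦ : ∀ (n : ℕ) (x : A ι), x ∈ ⋀[ℂ]^n (V ι) → Φ x ∈ ⋀[ℂ]^n (H1C K))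
    (hΦ' : ∀ (n : ℕ) (y : HBC K), y ∈ ⋀[ℂ]^n (H1C K) → Φ.symm y ∈ ⋀[ℂ]^n (V ι)) :
    IntegralModel Φ (intBC D) (volB D Φ) :=
  ⟨volB_ne_zero D Φ hι hΦ', intBC_Φ_eq D Φ hι hΦ⟩

end Proportional

end Summit.Ventures.HodgeRepro2.T6.A3IntegralModel
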